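import Mathlib
import HarnessLib

/-!
# The single-link map of a masked U(1) field-transformation layer: a circle diffeomorphism with the engine's log-det when the contraction indicator is `< 1` (sharp)

HONEST FRAMING: exact (Metropolis-corrected) sampling algorithms for lattice gauge theory;
figures of merit are autocorrelation/cost numbers at stated couplings and volumes; no
continuum-physics claim.

Venture `LatticeQCDFlow` (cell pub-lqcd), topic `Exactness`; FANOUT row 14 (`eng-flowhmc`: the
field-transformation HMC engine `latflow.fthmc`, lever family B, and its numpy twin `ref_u1`).  NEW
WORK of the cell over Mathlib (`strictMono_of_deriv_pos`, `intervalIntegral.integral_comp_mul_deriv`,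
`Function.Periodic.intervalIntegral_add_eq`, Banach's fixed-point theorem `ContractingWith.*`,
`Real.sin_gt_sub_cube`, the intermediate value theorem); nothing here is cited as a fact.  Printed
counterparts, NAMED ONLY: Lüscher 2010 (trivializing maps; the Euler step of the Wilson flow inside
HMC, inverted by fixed-point iteration); Jin 2022 / He–Jin–Osborn–Zhao 2025 (plaquette-driven neural
field transformations for U(1), "NTHMC"); Kanwar et al. 2020 (gauge-equivariant U(1) flows).
Companion: `Exactness/KickAngleMap.lean` (row 7) does the same for the CP(N−1) leading-order kick.

## The object

The engine's U(1) maps (`maps.u1_wilson_flow_lo`, `maps.u1_residual` with global or CNN-conditioned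
coefficients; twin `ref_u1.U1ResidualRef`) are compositions of MASKED LAYERS.  A layer moves only the
links of one direction and one parity class ("active") by

  `θ_ℓ' = θ_ℓ + Σ_j [ −e⁺_j sin(θ_ℓ + a⁺_j) + e⁻_j sin(a⁻_j − θ_ℓ) ]`,

where `a^±_j` are the `2(D−1)` staple angles of `ℓ` — functions of PASSIVE links only, by the masking —
and `e_j` the layer's coefficients (leading-order Wilson-flow map: all `e_j = ε`; trained members:
`e = (κ/2(D−1)) tanh(g [+ CNN(frozen plaquette features)])`).  Since `−e⁺ sin(θ + a⁺) = e⁺ sin((−a⁺) − θ)`,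
every active link undergoes a map of the single form

  `Φ(θ) = θ + Σ_{j<n} c_j sin(α_j − θ)`      (`c`, `α` frozen during the layer),

with `dΦ/dθ = 1 − C(θ)`, `C(θ) = Σ_j c_j cos(α_j − θ)` — the factor whose logarithm the engine
accumulates as the layer's log-det (`log det(layer) = Σ_active log(1 − C_ℓ)`, `ref_u1` docstring) —
and the engine REFUSES to build a layer unless the contraction indicator `κ = Σ_j |c_j|` (chain-header
field `contraction_indicator_max`, control X-8) is `< 1`.  This file proves what that certificate
buys, for ARBITRARY real coefficients `c : Fin n → ℝ` and angles `α : Fin n → ℝ`.  All statements are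
about the explicit expressions (no new definitions).

## Content

* `hasDerivAt_u1Layer` (`dΦ/dθ = 1 − C(θ)`), `abs_u1LayerC_le` (`|C(θ)| ≤ κ`), `u1LayerJac_pos`
  (`κ < 1 ⇒ 1 − C(θ) > 0`), `u1LayerJac_mem_Icc` (`1 − κ ≤ 1 − C ≤ 1 + κ`) and `log_u1LayerJac_mem_Icc`
  (the per-link log-det lies in `[log(1 − κ), log(1 + κ)]`: finite, no blow-up inside the certificate).
* `strictMono_u1Layer`, `injective_u1Layer` (`κ < 1`); `u1Layer_add_int_mul_two_pi`
  (`Φ(θ + 2πk) = Φ(θ) + 2πk`: a degree-one lift); `abs_u1Layer_sub_self_le` (`|Φ θ − θ| ≤ κ`: a layer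
  moves a link by at most `κ`); `continuous_u1Layer`, `surjective_u1Layer`, **`bijective_u1Layer`**; and
  the circle statement **`u1Layer_injective_mod_two_pi`** (`Φ θ₁ ≡ Φ θ₂ (mod 2π) ⇒ θ₁ ≡ θ₂ (mod 2π)`):
  with surjectivity, `Φ` induces a bijection of `ℝ/2πℤ`, i.e. of the U(1) link variable.
* **`integral_comp_u1Layer_period`** — for every continuous `2π`-periodic `g` and every `a`:
  `∫_a^{a+2π} g(Φ θ) (1 − C(θ)) dθ = ∫_a^{a+2π} g` — the Haar measure `dθ` of the link pulled back
  through `Φ` is `(1 − C) dθ`.  For `κ < 1` the factor is POSITIVE (`= |Φ'|`), so this is, link by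
  link, the Jacobian hypothesis `F_*(J · vol) = vol` of `Exactness/TransformedHMC.thmc_hmc_exact` with
  `J = 1 − C`: the log-det the engine subtracts in `S_eff = S ∘ F − Σ log(1 − C)` is the right one.
  (The identity holds for every `κ` — it is the degree-one property — but only for `κ < 1` is
  `(1 − C) dθ` a positive measure and `Φ` a bijection.)
* INVERSION (the engine's `inverse`, Lüscher's fixed-point iteration, unit test T2 / twin test R4):
  for a target `u` the map `T_u(θ) = u − Σ_j c_j sin(α_j − θ)` is `κ`-Lipschitz
  (`lipschitzWith_u1LayerInv`), a contraction for `κ < 1` (`contractingWith_u1LayerInv`) whose fixed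
  points are exactly the preimages of `u` (`isFixedPt_u1LayerInv_iff`): the Banach fixed point IS
  `Φ⁻¹(u)` (`u1Layer_fixedPoint`, `eq_fixedPoint_of_u1Layer_eq`), and the iterates from any start
  converge to it (`tendsto_iterate_u1LayerInv`) with `dist(T_u^[N] θ₀, Φ⁻¹ u) ≤ dist(θ₀, T_u θ₀) κ^N/(1 − κ)`
  (`dist_iterate_u1LayerInv_le`; from the engine's start `θ₀ = u`: `≤ κ^{N+1}/(1 − κ)`, `…_of_start`).
* SHARPNESS — **`u1Layer_fold_of_one_lt`**: for every `κ' > 1` the one-term map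
  `θ ↦ θ + κ' sin(α₀ − θ)` identifies two distinct points of the circle (`θ₁ < θ₂ < θ₁ + 2π`,
  `Φ θ₁ = Φ θ₂`), and **`u1Layer_fold_aligned`**: so does every `n`-term layer in the ALIGNED
  environment (all `α_j = α₀`) as soon as `Σ_j c_j > 1` — e.g. the leading-order map (`c_j = ε > 0`)
  with `2(D−1) ε > 1`.  Hence no certificate weaker than `Σ_j |c_j| ≤ 1` is uniform in the frozen
  environment: the refusal rule X-8 is the right one, not a convenience.  (At `Σ|c_j| = 1` exactly the
  map is still injective; the engine refuses `≥ 1` and the boundary is not treated here.)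
* `bijective_maskedLayer`, `bijective_u1MaskedLayer` — the whole LAYER (active links ↦ their
  single-link maps with the environment read off the passive links, passive links unchanged) is a
  bijection of the link configuration space (triangular structure); a member is a finite composition.

NOT here: the packaging as `HasJacobian` on a product of circles (the cell's U(1) files use
`2π`-periodic functions on `ℝ`, not `AddCircle` — cf. `Exactness/SteinCircle.lean`); the SU(N) layers
(matrix exponential; same indicator, not typed here); anything about acceptance or autocorrelation.
-/

noncomputable section

namespace Summit.Ventures.LatticeQCDFlow.Exactness

open Real Set Filter Finset Function
open scoped Topology NNReal

variable {n : ℕ} (c α : Fin n → ℝ)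

/-! ## The derivative and the Jacobian factor -/

/-- `dΦ/dθ = 1 − Σ_j c_j cos(α_j − θ)` for the single-link layer map
`Φ(θ) = θ + Σ_j c_j sin(α_j − θ)`. -/
theorem hasDerivAt_u1Layer (θ : ℝ) :
    HasDerivAt (fun θ : ℝ => θ + ∑ j, c j * sin (α j - θ)) (1 - ∑ j, c j * cos (α j - θ)) θ := by
  have h : ∀ j ∈ (univ : Finset (Fin n)),
      HasDerivAt (fun x : ℝ => c j * sin (α j - x)) (-(c j * cos (α j - θ))) θ := by
    intro j _
    exact ((((hasDerivAt_id' θ).const_sub (α j)).sin).const_mul (c j)).congr_deriv (by ring)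
  exact ((hasDerivAt_id' θ).fun_add (HasDerivAt.fun_sum h)).congr_deriv
    (by rw [Finset.sum_neg_distrib]; ring)

/-- `|C(θ)| = |Σ_j c_j cos(α_j − θ)| ≤ κ = Σ_j |c_j|`. -/
theorem abs_u1LayerC_le (θ : ℝ) : |∑ j, c j * cos (α j - θ)| ≤ ∑ j, |c j| := by
  refine (Finset.abs_sum_le_sum_abs _ _).trans (Finset.sum_le_sum fun j _ => ?_)
  rw [abs_mul]
  exact mul_le_of_le_one_right (abs_nonneg _) (abs_cos_le_one _)

/-- `|Σ_j c_j sin(α_j − θ)| ≤ κ`. -/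
theorem abs_u1LayerS_le (θ : ℝ) : |∑ j, c j * sin (α j - θ)| ≤ ∑ j, |c j| := by
  refine (Finset.abs_sum_le_sum_abs _ _).trans (Finset.sum_le_sum fun j _ => ?_)
  rw [abs_mul]
  exact mul_le_of_le_one_right (abs_nonneg _) (abs_sin_le_one _)

/-- Two-sided bound on the Jacobian factor: `1 − κ ≤ 1 − C(θ) ≤ 1 + κ`. -/
theorem u1LayerJac_mem_Icc (θ : ℝ) :
    1 - ∑ j, c j * cos (α j - θ) ∈ Icc (1 - ∑ j, |c j|) (1 + ∑ j, |c j|) := by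
  have h := abs_le.1 (abs_u1LayerC_le c α θ)
  exact ⟨by linarith [h.2], by linarith [h.1]⟩

/-- **Inside the certificate the Jacobian factor is positive**: `Σ_j |c_j| < 1 ⇒ 1 − C(θ) > 0`. -/
theorem u1LayerJac_pos (hκ : ∑ j, |c j| < 1) (θ : ℝ) : 0 < 1 - ∑ j, c j * cos (α j - θ) := by
  have h := (abs_le.1 (abs_u1LayerC_le c α θ)).2
  linarith

/-- The per-link log-det `log(1 − C(θ))` lies in `[log(1 − κ), log(1 + κ)]` when `κ < 1`. -/
theorem log_u1LayerJac_mem_Icc (hκ : ∑ j, |c j| < 1) (θ : ℝ) :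
    Real.log (1 - ∑ j, c j * cos (α j - θ)) ∈
      Icc (Real.log (1 - ∑ j, |c j|)) (Real.log (1 + ∑ j, |c j|)) := by
  have h := u1LayerJac_mem_Icc c α θ
  have h0 : 0 < 1 - ∑ j, |c j| := by linarith
  exact ⟨Real.log_le_log h0 h.1, Real.log_le_log (u1LayerJac_pos c α hκ θ) h.2⟩

/-! ## Monotonicity, degree one, bijectivity of `ℝ` and of the circle -/

/-- **For `Σ_j |c_j| < 1` the single-link map is strictly increasing.** -/
theorem strictMono_u1Layer (hκ : ∑ j, |c j| < 1) :
    StrictMono (fun θ : ℝ => θ + ∑ j, c j * sin (α j - θ)) :=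
  strictMono_of_deriv_pos fun θ => by
    rw [(hasDerivAt_u1Layer c α θ).deriv]
    exact u1LayerJac_pos c α hκ θ

/-- … hence injective on `ℝ`. -/
theorem injective_u1Layer (hκ : ∑ j, |c j| < 1) :
    Function.Injective (fun θ : ℝ => θ + ∑ j, c j * sin (α j - θ)) :=
  (strictMono_u1Layer c α hκ).injective

/-- The single-link map is continuous. -/
theorem continuous_u1Layer : Continuous (fun θ : ℝ => θ + ∑ j, c j * sin (α j - θ)) :=
  continuous_id.add (continuous_finsetSum _ fun _ _ =>
    continuous_const.mul (continuous_sin.comp (continuous_const.sub continuous_id)))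

/-- **Degree one**: `Φ(θ + 2πk) = Φ(θ) + 2πk` for every integer `k` (the displacement
`Σ_j c_j sin(α_j − θ)` is `2π`-periodic). -/
theorem u1Layer_add_int_mul_two_pi (θ : ℝ) (k : ℤ) :
    (θ + k * (2 * π)) + ∑ j, c j * sin (α j - (θ + k * (2 * π))) =
      (θ + ∑ j, c j * sin (α j - θ)) + k * (2 * π) := by
  have h : ∀ j, sin (α j - (θ + k * (2 * π))) = sin (α j - θ) := fun j => by
    rw [sub_add_eq_sub_sub, sin_sub_int_mul_two_pi]
  simp only [h]
  ring

/-- `Φ(θ + 2π) = Φ(θ) + 2π`. -/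
theorem u1Layer_add_two_pi (θ : ℝ) :
    (θ + 2 * π) + ∑ j, c j * sin (α j - (θ + 2 * π)) =
      (θ + ∑ j, c j * sin (α j - θ)) + 2 * π := by
  have h : ∀ j, sin (α j - (θ + 2 * π)) = sin (α j - θ) := fun j => by
    rw [sub_add_eq_sub_sub, sin_sub_two_pi]
  simp only [h]
  ring

/-- A layer moves a link by at most `κ`: `|Φ θ − θ| ≤ Σ_j |c_j|`. -/
theorem abs_u1Layer_sub_self_le (θ : ℝ) :
    |(θ + ∑ j, c j * sin (α j - θ)) - θ| ≤ ∑ j, |c j| := by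
  rw [add_sub_cancel_left]
  exact abs_u1LayerS_le c α θ

/-- The single-link map is surjective onto `ℝ` (for any coefficients: the displacement is bounded). -/
theorem surjective_u1Layer : Function.Surjective (fun θ : ℝ => θ + ∑ j, c j * sin (α j - θ)) := by
  refine (continuous_u1Layer c α).surjective ?_ ?_
  · refine tendsto_atTop_mono (fun θ => ?_)
      (tendsto_atTop_add_const_right atTop (-∑ j, |c j|) tendsto_id)
    have h := (abs_le.1 (abs_u1LayerS_le c α θ)).1
    simp only [id_eq]; linarith
  · refine tendsto_atBot_mono (fun θ => ?_)
      (tendsto_atBot_add_const_right atBot (∑ j, |c j|) tendsto_id)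
    have h := (abs_le.1 (abs_u1LayerS_le c α θ)).2
    simp only [id_eq]; linarith

/-- **For `Σ_j |c_j| < 1` the single-link map is a bijection of `ℝ`** (a strictly increasing
self-homeomorphism commuting with translation by `2π`). -/
theorem bijective_u1Layer (hκ : ∑ j, |c j| < 1) :
    Function.Bijective (fun θ : ℝ => θ + ∑ j, c j * sin (α j - θ)) :=
  ⟨injective_u1Layer c α hκ, surjective_u1Layer c α⟩

/-- **Injective on the circle**: if `Φ θ₁ = Φ θ₂ + 2πk` then `θ₁ = θ₂ + 2πk` (`Σ_j |c_j| < 1`).  With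
`surjective_u1Layer` and `u1Layer_add_int_mul_two_pi`, `Φ` induces a bijection of `ℝ/2πℤ` — of the
U(1) link variable. -/
theorem u1Layer_injective_mod_two_pi (hκ : ∑ j, |c j| < 1) {θ₁ θ₂ : ℝ} {k : ℤ}
    (h : θ₁ + ∑ j, c j * sin (α j - θ₁) = (θ₂ + ∑ j, c j * sin (α j - θ₂)) + k * (2 * π)) :
    θ₁ = θ₂ + k * (2 * π) := by
  rw [← u1Layer_add_int_mul_two_pi c α θ₂ k] at h
  exact (injective_u1Layer c α hκ) h

/-- Every point of the circle is hit: for every `u` there are `θ` and an integer `k` with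
`Φ θ + 2πk = u` and `θ` in the fundamental period `[a, a + 2π)`. -/
theorem u1Layer_surjective_mod_two_pi (a u : ℝ) :
    ∃ θ ∈ Ico a (a + 2 * π), ∃ k : ℤ, (θ + ∑ j, c j * sin (α j - θ)) + k * (2 * π) = u := by
  obtain ⟨θ₀, hθ₀⟩ := surjective_u1Layer c α u
  -- reduce `θ₀` into the period `[a, a + 2π)`: `θ₀ = θ + k • 2π`
  refine ⟨toIcoMod two_pi_pos a θ₀, toIcoMod_mem_Ico two_pi_pos a θ₀, toIcoDiv two_pi_pos a θ₀, ?_⟩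
  have e : toIcoMod two_pi_pos a θ₀ + (toIcoDiv two_pi_pos a θ₀ : ℝ) * (2 * π) = θ₀ := by
    rw [← zsmul_eq_mul]; exact toIcoMod_add_toIcoDiv_zsmul two_pi_pos a θ₀
  have h := u1Layer_add_int_mul_two_pi c α (toIcoMod two_pi_pos a θ₀) (toIcoDiv two_pi_pos a θ₀)
  rw [e] at h
  simp only at hθ₀
  rwa [h] at hθ₀

/-! ## Change of variables on a period: the pulled-back Haar measure is `(1 − C) dθ` -/

/-- **The log-det is the right one.**  For every continuous `2π`-periodic `g` and every `a`,
`∫_a^{a+2π} g(Φ θ) · (1 − C(θ)) dθ = ∫_a^{a+2π} g(θ) dθ`: the Haar measure of the link pulled back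
through the layer map is `(1 − C) dθ`; for `Σ|c_j| < 1` the density is positive (`u1LayerJac_pos`)
and the map bijective, which is the single-link content of the Jacobian hypothesis of
`thmc_hmc_exact`. -/
theorem integral_comp_u1Layer_period (a : ℝ) {g : ℝ → ℝ} (hg : Continuous g)
    (hper : Function.Periodic g (2 * π)) :
    ∫ θ in a..a + 2 * π, g (θ + ∑ j, c j * sin (α j - θ)) * (1 - ∑ j, c j * cos (α j - θ)) =
      ∫ θ in a..a + 2 * π, g θ := by
  have hcont : Continuous fun θ : ℝ => 1 - ∑ j, c j * cos (α j - θ) :=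
    continuous_const.sub (continuous_finsetSum _ fun _ _ =>
      continuous_const.mul (continuous_cos.comp (continuous_const.sub continuous_id)))
  have h1 := intervalIntegral.integral_comp_mul_deriv (a := a) (b := a + 2 * π)
    (fun θ _ => hasDerivAt_u1Layer c α θ) hcont.continuousOn hg
  rw [u1Layer_add_two_pi c α a, hper.intervalIntegral_add_eq _ a] at h1
  simpa only [Function.comp_apply] using h1

/-! ## Inversion by fixed-point iteration (Banach) -/

/-- The inversion map `T_u(θ) = u − Σ_j c_j sin(α_j − θ)` is `κ`-Lipschitz, `κ = Σ_j |c_j|`. -/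
theorem lipschitzWith_u1LayerInv (u : ℝ) :
    LipschitzWith (Real.toNNReal (∑ j, |c j|)) (fun θ : ℝ => u - ∑ j, c j * sin (α j - θ)) := by
  refine LipschitzWith.of_dist_le_mul fun θ₁ θ₂ => ?_
  rw [Real.coe_toNNReal _ (Finset.sum_nonneg fun j _ => abs_nonneg (c j)), Real.dist_eq, Real.dist_eq]
  have e : (u - ∑ j, c j * sin (α j - θ₁)) - (u - ∑ j, c j * sin (α j - θ₂)) =
      ∑ j, c j * (sin (α j - θ₂) - sin (α j - θ₁)) := by
    simp only [mul_sub, Finset.sum_sub_distrib]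
    ring
  rw [e]
  calc |∑ j, c j * (sin (α j - θ₂) - sin (α j - θ₁))|
      ≤ ∑ j, |c j * (sin (α j - θ₂) - sin (α j - θ₁))| := Finset.abs_sum_le_sum_abs _ _
    _ ≤ ∑ j, |c j| * |θ₁ - θ₂| := Finset.sum_le_sum fun j _ => by
        rw [abs_mul]
        refine mul_le_mul_of_nonneg_left ?_ (abs_nonneg _)
        calc |sin (α j - θ₂) - sin (α j - θ₁)| ≤ |(α j - θ₂) - (α j - θ₁)| := abs_sin_sub_sin_le _ _
          _ = |θ₁ - θ₂| := by congr 1; ring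
    _ = (∑ j, |c j|) * |θ₁ - θ₂| := by rw [Finset.sum_mul]

/-- **For `Σ_j |c_j| < 1` the inversion map is a contraction of `ℝ`.** -/
theorem contractingWith_u1LayerInv (hκ : ∑ j, |c j| < 1) (u : ℝ) :
    ContractingWith (Real.toNNReal (∑ j, |c j|)) (fun θ : ℝ => u - ∑ j, c j * sin (α j - θ)) :=
  ⟨Real.toNNReal_lt_one.2 hκ, lipschitzWith_u1LayerInv c α u⟩

/-- The fixed points of `T_u` are exactly the preimages of `u` under the layer map. -/
theorem isFixedPt_u1LayerInv_iff (u θ : ℝ) :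
    Function.IsFixedPt (fun θ : ℝ => u - ∑ j, c j * sin (α j - θ)) θ ↔
      θ + ∑ j, c j * sin (α j - θ) = u := by
  rw [Function.IsFixedPt]
  constructor <;> intro h <;> linarith

/-- **The Banach fixed point of `T_u` is the preimage `Φ⁻¹(u)`.** -/
theorem u1Layer_fixedPoint (hκ : ∑ j, |c j| < 1) (u : ℝ) :
    ContractingWith.fixedPoint _ (contractingWith_u1LayerInv c α hκ u) +
        ∑ j, c j * sin (α j - ContractingWith.fixedPoint _ (contractingWith_u1LayerInv c α hκ u)) =
      u :=
  (isFixedPt_u1LayerInv_iff c α u _).1 (contractingWith_u1LayerInv c α hκ u).fixedPoint_isFixedPt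

/-- … and every solution of `Φ θ = u` is that fixed point (uniqueness of the preimage). -/
theorem eq_fixedPoint_of_u1Layer_eq (hκ : ∑ j, |c j| < 1) {u θ : ℝ}
    (h : θ + ∑ j, c j * sin (α j - θ) = u) :
    θ = ContractingWith.fixedPoint _ (contractingWith_u1LayerInv c α hκ u) :=
  (contractingWith_u1LayerInv c α hκ u).fixedPoint_unique ((isFixedPt_u1LayerInv_iff c α u θ).2 h)

/-- **The iteration converges to the preimage** from any start. -/
theorem tendsto_iterate_u1LayerInv (hκ : ∑ j, |c j| < 1) (u θ₀ : ℝ) :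
    Tendsto (fun N => (fun θ : ℝ => u - ∑ j, c j * sin (α j - θ))^[N] θ₀) atTop
      (𝓝 (ContractingWith.fixedPoint _ (contractingWith_u1LayerInv c α hκ u))) :=
  (contractingWith_u1LayerInv c α hκ u).tendsto_iterate_fixedPoint θ₀

/-- **A-priori geometric error bound**: after `N` iterations from `θ₀` the distance to the preimage
is at most `dist(θ₀, T_u θ₀) · κ^N / (1 − κ)`. -/
theorem dist_iterate_u1LayerInv_le (hκ : ∑ j, |c j| < 1) (u θ₀ : ℝ) (N : ℕ) :
    dist ((fun θ : ℝ => u - ∑ j, c j * sin (α j - θ))^[N] θ₀)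
        (ContractingWith.fixedPoint _ (contractingWith_u1LayerInv c α hκ u)) ≤
      dist θ₀ (u - ∑ j, c j * sin (α j - θ₀)) * (∑ j, |c j|) ^ N / (1 - ∑ j, |c j|) := by
  have h := (contractingWith_u1LayerInv c α hκ u).apriori_dist_iterate_fixedPoint_le θ₀ N
  rwa [Real.coe_toNNReal _ (Finset.sum_nonneg fun j _ => abs_nonneg (c j))] at h

/-- From the engine's start `θ₀ = u` the bound reads `κ · κ^N / (1 − κ)`. -/
theorem dist_iterate_u1LayerInv_le_of_start (hκ : ∑ j, |c j| < 1) (u : ℝ) (N : ℕ) :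
    dist ((fun θ : ℝ => u - ∑ j, c j * sin (α j - θ))^[N] u)
        (ContractingWith.fixedPoint _ (contractingWith_u1LayerInv c α hκ u)) ≤
      (∑ j, |c j|) * (∑ j, |c j|) ^ N / (1 - ∑ j, |c j|) := by
  refine (dist_iterate_u1LayerInv_le c α hκ u u N).trans ?_
  have h1 : dist u (u - ∑ j, c j * sin (α j - u)) ≤ ∑ j, |c j| := by
    rw [Real.dist_eq, sub_sub_cancel]
    exact abs_u1LayerS_le c α u
  have h2 : 0 < 1 - ∑ j, |c j| := by linarith
  gcongr

/-! ## Sharpness: beyond the certificate the aligned environment folds -/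

/-- **Sharpness, one term.**  For `κ' > 1` the map `θ ↦ θ + κ' sin(α₀ − θ)` identifies two
distinct points of the circle: there are `θ₁ < θ₂ < θ₁ + 2π` with the same image.  (`θ₁ = α₀` is a
fixed point; just past it the map DEcreases, since its derivative there is `1 − κ' < 0`, while a full
turn later it has advanced by `2π`; the intermediate value theorem supplies `θ₂`.) -/
theorem u1Layer_fold_of_one_lt {κ' : ℝ} (hκ : 1 < κ') (α₀ : ℝ) :
    ∃ θ₁ θ₂ : ℝ, θ₁ < θ₂ ∧ θ₂ < θ₁ + 2 * π ∧
      θ₁ + κ' * sin (α₀ - θ₁) = θ₂ + κ' * sin (α₀ - θ₂) := by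
  have hκ0 : 0 < κ' := zero_lt_one.trans hκ
  have hκne : κ' ≠ 0 := hκ0.ne'
  set δ : ℝ := (κ' - 1) / κ' with hδ
  have hδpos : 0 < δ := div_pos (by linarith) hκ0
  have hδlt1 : δ < 1 := by rw [hδ, div_lt_one hκ0]; linarith
  have hκδ : κ' * (1 - δ) = 1 := by rw [hδ]; field_simp; ring
  -- `κ' sin δ > δ`
  have hsin : δ < κ' * sin δ := by
    have hs : δ - δ ^ 3 / 6 < sin δ := sin_gt_sub_cube hδpos
    have hδδ : δ * δ < δ * 1 := mul_lt_mul_of_pos_left hδlt1 hδpos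
    have h2 : κ' * (1 - δ) ≤ κ' * (1 - δ ^ 2 / 6) :=
      mul_le_mul_of_nonneg_left (by nlinarith) hκ0.le
    rw [hκδ] at h2
    have h1 : δ ≤ κ' * (δ - δ ^ 3 / 6) := by
      rw [show κ' * (δ - δ ^ 3 / 6) = δ * (κ' * (1 - δ ^ 2 / 6)) by ring]
      nlinarith
    have h3 : κ' * (δ - δ ^ 3 / 6) < κ' * sin δ := mul_lt_mul_of_pos_left hs hκ0
    linarith
  -- the map, its values at `α₀`, `α₀ + δ`, `α₀ + 2π`
  set Φ : ℝ → ℝ := fun θ => θ + κ' * sin (α₀ - θ) with hΦ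
  have hΦcont : Continuous Φ :=
    continuous_id.add (continuous_const.mul (continuous_sin.comp (continuous_const.sub continuous_id)))
  have hΦ2π : Φ (α₀ + 2 * π) = α₀ + 2 * π := by
    simp only [hΦ]
    rw [show α₀ - (α₀ + 2 * π) = -(2 * π) by ring, sin_neg, sin_two_pi]; ring
  have hΦδ : Φ (α₀ + δ) < α₀ := by
    simp only [hΦ]
    rw [show α₀ - (α₀ + δ) = -δ by ring, sin_neg]; linarith
  have hle : α₀ + δ ≤ α₀ + 2 * π := by linarith [pi_gt_three]
  have hmem : α₀ ∈ Ioo (Φ (α₀ + δ)) (Φ (α₀ + 2 * π)) :=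
    ⟨hΦδ, by rw [hΦ2π]; linarith [pi_pos]⟩
  obtain ⟨θ₂, hθ₂, hΦθ₂⟩ := intermediate_value_Ioo hle hΦcont.continuousOn hmem
  refine ⟨α₀, θ₂, by linarith [hθ₂.1], hθ₂.2, ?_⟩
  rw [sub_self, sin_zero, mul_zero, add_zero]
  exact hΦθ₂.symm

/-- **Sharpness, aligned environment.**  An `n`-term layer whose frozen angles coincide
(`α_j = α₀`) and whose coefficients sum to more than `1` — e.g. the leading-order Wilson-flow layer
with `2(D−1) ε > 1` — identifies two distinct points of the circle. -/
theorem u1Layer_fold_aligned (hc : 1 < ∑ j, c j) (α₀ : ℝ) :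
    ∃ θ₁ θ₂ : ℝ, θ₁ < θ₂ ∧ θ₂ < θ₁ + 2 * π ∧
      θ₁ + ∑ j, c j * sin (α₀ - θ₁) = θ₂ + ∑ j, c j * sin (α₀ - θ₂) := by
  simp_rw [← Finset.sum_mul]
  exact u1Layer_fold_of_one_lt hc α₀

/-! ## The whole masked layer -/

/-- **A masked layer is a bijection of the configuration space.**  Passive coordinates `p` are
unchanged and determine the environment; each active coordinate `i` is moved by its own map
`F p i`, a bijection for every environment.  Then `(a, p) ↦ (i ↦ F p i (a i), p)` is a bijection —
the triangular structure behind `log det(layer) = Σ_active log(1 − C_ℓ)`. -/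
theorem bijective_maskedLayer {ι P X : Type*} (F : P → ι → X → X)
    (hF : ∀ p i, Function.Bijective (F p i)) :
    Function.Bijective (fun x : (ι → X) × P => (fun i => F x.2 i (x.1 i), x.2)) := by
  constructor
  · rintro ⟨a, p⟩ ⟨b, q⟩ h
    simp only [Prod.mk.injEq] at h
    obtain ⟨h1, rfl⟩ := h
    exact Prod.ext (funext fun i => (hF p i).1 (congr_fun h1 i)) rfl
  · rintro ⟨b, p⟩
    refine ⟨(fun i => ((hF p i).2 (b i)).choose, p), ?_⟩
    simp only [Prod.mk.injEq, and_true]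
    funext i
    exact ((hF p i).2 (b i)).choose_spec

/-- The U(1) layer instance: with environments `(c p i, α p i)` of contraction indicator `< 1` for
every passive configuration `p` and active link `i`, the masked layer is a bijection of
`(active links → ℝ) × (passive data)`. -/
theorem bijective_u1MaskedLayer {ι P : Type*} (cₚ αₚ : P → ι → Fin n → ℝ)
    (hκ : ∀ p i, ∑ j, |cₚ p i j| < 1) :
    Function.Bijective (fun x : (ι → ℝ) × P =>
      (fun i => x.1 i + ∑ j, cₚ x.2 i j * sin (αₚ x.2 i j - x.1 i), x.2)) :=
  bijective_maskedLayer (fun p i θ => θ + ∑ j, cₚ p i j * sin (αₚ p i j - θ))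
    fun p i => bijective_u1Layer (cₚ p i) (αₚ p i) (hκ p i)

end Summit.Ventures.LatticeQCDFlow.Exactness
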